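import Mathlib
import HarnessLib

/-!
# Goldstine's theorem

**Goldstine's theorem** (Goldstine 1938; Conway [cite: Conway1985, Ch. V §4, Prop. 4.1]): for a
real normed space `X`, the canonical image of the closed unit ball of `X` in the bidual `X**` is
weak-* (`σ(X**, X*)`) dense in the closed unit ball of `X**`; consequently the canonical image of
`X` is weak-* dense in `X**`.  Mathlib has the canonical embedding
(`NormedSpace.inclusionInDoubleDual`; `NormedSpace.inclusionInDoubleDualWeak` into the weak-*
bidual `WeakDual ℝ (StrongDual ℝ X)`) and the Banach–Alaoglu side (`WeakDual.isClosed_closedBall`,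
`WeakDual.isCompact_closedBall`), but not the density statement.

Proof.  The separation argument of Conway's proof is run in finite dimensions, which gives the
finite-dimensional core usually called **Helly's lemma** (`exists_mem_closedBall_forall_abs_sub_lt`):
for `‖Φ‖ ≤ R`, finitely many functionals `g ∈ F ⊆ X*` and `δ > 0` there is `x` with `‖x‖ ≤ R` and
`|g x - Φ g| < δ` for all `g ∈ F` — otherwise the evaluation vector `(Φ g)_{g ∈ F}` lies outside the
closed convex set `closure {(g x)_{g ∈ F} : ‖x‖ ≤ R} ⊆ ℝ^F`, a separating functional
`y ↦ ∑ w_g y_g` (geometric Hahn–Banach in `ℝ^F`) yields `G = ∑ w_g g ∈ X*` with `G x < u` on the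
`R`-ball, hence `R ‖G‖ ≤ u`, contradicting `u < Φ G ≤ ‖Φ‖ ‖G‖ ≤ R ‖G‖`.  Since weak-* convergence
is pointwise convergence on `X*` (`tendsto_iff_forall_eval_tendsto_topDualPairing`), the
approximants indexed by `(F, k) ∈ Finset X* × ℕ` converge weak-* to `Φ`, which is therefore in the
weak-* closure of the image of the `R`-ball.

* `embed X x` — the point `x` seen in the weak-* bidual; `ballImage X` — the image of the closed
  unit ball; `bidualBall X` — the closed unit ball of `X**` inside the weak-* bidual;
* `mul_opNorm_le_of_forall_mem_closedBall_lt` — `(∀ ‖x‖ ≤ R, g x < u) → R ‖g‖ ≤ u`;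
* `exists_mem_closedBall_forall_abs_sub_lt` — Helly's lemma (finite-dimensional core);
* `mem_closure_image_closedBall`, `mem_closure_ballImage` — **Goldstine**, pointwise form;
* `closure_ballImage_eq` — `closure (ballImage X) = bidualBall X`;
* `dense_range_embed` — the canonical image of `X` is weak-* dense in `X**`.

Scalars are real.
-/

open Metric Set NormedSpace Topology Filter Finset

noncomputable section

namespace Literature.Analysis.FunctionSpaces.Goldstine

variable (X : Type*) [NormedAddCommGroup X] [NormedSpace ℝ X]

/-- The canonical image of `x : X` in the bidual, as a point of the weak-* bidual
`WeakDual ℝ (StrongDual ℝ X)`. [folklore] -/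
def embed (x : X) : WeakDual ℝ (StrongDual ℝ X) :=
  StrongDual.toWeakDual (inclusionInDoubleDual ℝ X x)

/-- The canonical image of the closed unit ball of `X` in the weak-* bidual. [folklore] -/
def ballImage : Set (WeakDual ℝ (StrongDual ℝ X)) := embed X '' closedBall (0 : X) 1

/-- The closed unit ball of `X**`, as a subset of the weak-* bidual. [folklore] -/
def bidualBall : Set (WeakDual ℝ (StrongDual ℝ X)) :=
  {Ψ | ‖WeakDual.toStrongDual Ψ‖ ≤ 1}

variable {X}

/-- Evaluation of the canonical embedding: `embed X x g = g x`. [folklore] -/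
@[simp] private theorem embed_apply (x : X) (g : StrongDual ℝ X) : embed X x g = g x := rfl

/-- `embed` is Mathlib's `inclusionInDoubleDualWeak` precomposed with `toWeakSpace`. [folklore] -/
private theorem embed_eq_inclusionInDoubleDualWeak (x : X) :
    embed X x = inclusionInDoubleDualWeak ℝ X (toWeakSpace ℝ X x) := rfl

/-- `toStrongDual (embed X x)` is the evaluation functional at `x`. [folklore] -/
private theorem toStrongDual_embed (x : X) :
    WeakDual.toStrongDual (embed X x) = inclusionInDoubleDual ℝ X x := rfl

/-- `toWeakDual ∘ toStrongDual` is the identity on the weak-* bidual. [folklore] -/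
private theorem toWeakDual_toStrongDual (Ψ : WeakDual ℝ (StrongDual ℝ X)) :
    StrongDual.toWeakDual (WeakDual.toStrongDual Ψ) = Ψ := rfl

/-- The canonical embedding does not increase the norm. [folklore] -/
private theorem norm_toStrongDual_embed_le (x : X) : ‖WeakDual.toStrongDual (embed X x)‖ ≤ ‖x‖ := by
  rw [toStrongDual_embed]
  exact double_dual_bound ℝ X x

/-- The image of the ball lies in the bidual ball. [folklore] -/
private theorem ballImage_subset_bidualBall : ballImage X ⊆ bidualBall X := by
  rintro _ ⟨x, hx, rfl⟩
  have hx' : ‖x‖ ≤ 1 := by simpa using hx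
  exact (norm_toStrongDual_embed_le x).trans hx'

/-- The bidual ball is weak-* closed (Mathlib's `WeakDual.isClosed_closedBall`). [folklore] -/
private theorem isClosed_bidualBall : IsClosed (bidualBall X) := by
  have h := WeakDual.isClosed_closedBall (𝕜 := ℝ) (E := StrongDual ℝ X) 0 1
  convert h using 1
  ext Ψ
  simp [bidualBall]

/-- The weak-* closure of the image of the unit ball lies in the bidual unit ball. [folklore] -/
private theorem closure_ballImage_subset : closure (ballImage X) ⊆ bidualBall X :=
  closure_minimal ballImage_subset_bidualBall isClosed_bidualBall

/-! ### A one-sided bound on a ball controls the norm -/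

/-- If `g x < u` for all `‖x‖ ≤ R` (`R > 0`), then `R ‖g‖ ≤ u`. [folklore] -/
private theorem mul_opNorm_le_of_forall_mem_closedBall_lt {g : StrongDual ℝ X} {u R : ℝ} (hR : 0 < R)
    (h : ∀ x ∈ closedBall (0 : X) R, g x < u) : R * ‖g‖ ≤ u := by
  have hu : 0 < u := by simpa using h 0 (by simp [hR.le])
  suffices hg : ‖g‖ ≤ u / R by
    calc R * ‖g‖ ≤ R * (u / R) := by gcongr
      _ = u := by field_simp
  refine ContinuousLinearMap.opNorm_le_bound _ (div_nonneg hu.le hR.le) fun x => ?_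
  by_cases hx : x = 0
  · simp [hx]
  have hxn : 0 < ‖x‖ := norm_pos_iff.mpr hx
  set y : X := (R * ‖x‖⁻¹) • x with hy
  have hyn : ‖y‖ = R := by
    rw [hy, norm_smul, Real.norm_eq_abs, abs_of_pos (by positivity), mul_assoc,
      inv_mul_cancel₀ hxn.ne', mul_one]
  have hy1 : y ∈ closedBall (0 : X) R := by simp [hyn]
  have hy2 : -y ∈ closedBall (0 : X) R := by simp [hyn]
  have h1 := h y hy1
  have h2 := h (-y) hy2
  rw [map_neg] at h2
  have hgy : |g y| ≤ u := abs_le.mpr ⟨by linarith, h1.le⟩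
  have hgx : g x = ‖x‖ / R * g y := by
    rw [hy, map_smul, smul_eq_mul]
    field_simp
  rw [Real.norm_eq_abs, hgx, abs_mul, abs_of_pos (by positivity)]
  calc ‖x‖ / R * |g y| ≤ ‖x‖ / R * u := by gcongr
    _ = u / R * ‖x‖ := by ring

/-! ### Helly's lemma: the finite-dimensional core -/

/-- **Helly's lemma** (approximate form; the finite-dimensional core of Goldstine's theorem): if
`‖Φ‖ ≤ R`, then for finitely many functionals `g ∈ F` and `δ > 0` some `x` with `‖x‖ ≤ R` has
`|g x - Φ g| < δ` for all `g ∈ F`.  Geometric Hahn–Banach in `ℝ^F`.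
[cite: Conway1985, Ch. V §4, Prop. 4.1 (proof)] -/
theorem exists_mem_closedBall_forall_abs_sub_lt (F : Finset (StrongDual ℝ X))
    (Φ : StrongDual ℝ (StrongDual ℝ X)) {R : ℝ} (hΦ : ‖Φ‖ ≤ R) {δ : ℝ} (hδ : 0 < δ) :
    ∃ x ∈ closedBall (0 : X) R, ∀ g ∈ F, |g x - Φ g| < δ := by
  classical
  by_cases h0 : Φ = 0
  · refine ⟨0, by simpa using (norm_nonneg Φ).trans hΦ, fun g _ => by simpa [h0] using hδ⟩
  have hΦpos : 0 < ‖Φ‖ := lt_of_le_of_ne (ContinuousLinearMap.opNorm_nonneg Φ) fun h =>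
    h0 ((ContinuousLinearMap.opNorm_zero_iff Φ).mp h.symm)
  have hR : 0 < R := lt_of_lt_of_le hΦpos hΦ
  -- the evaluation map into `ℝ^F`
  let T : X →ₗ[ℝ] (F → ℝ) := LinearMap.pi fun g : F => (g : StrongDual ℝ X).toLinearMap
  have hT : ∀ x (g : F), T x g = (g : StrongDual ℝ X) x := fun x g => rfl
  let S : Set (F → ℝ) := T '' closedBall (0 : X) R
  have hS : Convex ℝ S := (convex_closedBall (0 : X) R).is_linear_image T.isLinear
  let c : F → ℝ := fun g => Φ (g : StrongDual ℝ X)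
  have hc : c ∈ closure S := by
    by_contra hc
    obtain ⟨lam, u, hSu, hcu⟩ := geometric_hahn_banach_closed_point hS.closure isClosed_closure hc
    let w : F → ℝ := fun i => lam fun j => if i = j then 1 else 0
    have hlam : ∀ y : F → ℝ, lam y = ∑ i, y i * w i := by
      intro y
      have := (lam : (F → ℝ) →L[ℝ] ℝ).toLinearMap.pi_apply_eq_sum_univ y
      simpa [w] using this
    let G : StrongDual ℝ X := ∑ i : F, w i • (i : StrongDual ℝ X)
    have hG : ∀ x, G x = ∑ i : F, w i * (i : StrongDual ℝ X) x := by
      intro x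
      simp [G]
    have hTG : ∀ x, lam (T x) = G x := by
      intro x
      rw [hlam, hG]
      exact Finset.sum_congr rfl fun i _ => by rw [hT, mul_comm]
    have h1 : ∀ x ∈ closedBall (0 : X) R, G x < u := fun x hx => by
      rw [← hTG]
      exact hSu _ (subset_closure ⟨x, hx, rfl⟩)
    have hGn : R * ‖G‖ ≤ u := mul_opNorm_le_of_forall_mem_closedBall_lt hR h1
    have hΦG : Φ G = ∑ i : F, w i * Φ (i : StrongDual ℝ X) := by
      simp [G, map_sum, map_smul]
    have h2 : u < Φ G := by
      have := hcu
      rw [hlam] at this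
      rw [hΦG]
      calc u < ∑ i, c i * w i := this
        _ = ∑ i, w i * Φ (i : StrongDual ℝ X) := Finset.sum_congr rfl fun i _ => mul_comm _ _
    have h3 : Φ G ≤ ‖Φ‖ * ‖G‖ := (le_abs_self _).trans (by simpa using Φ.le_opNorm G)
    have h4 : ‖Φ‖ * ‖G‖ ≤ R * ‖G‖ := mul_le_mul_of_nonneg_right hΦ (norm_nonneg _)
    linarith
  rw [Metric.mem_closure_iff] at hc
  obtain ⟨_, ⟨x, hx, rfl⟩, hdist⟩ := hc δ hδ
  refine ⟨x, hx, fun g hg => ?_⟩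
  have h := dist_le_pi_dist c (T x) ⟨g, hg⟩
  rw [Real.dist_eq, hT] at h
  rw [abs_sub_comm]
  exact lt_of_le_of_lt h hdist

/-! ### Goldstine's theorem -/

/-- **Goldstine's theorem**, pointwise form with radius: if `‖Φ‖ ≤ R` then `Φ` lies in the weak-*
closure of the canonical image of the closed `R`-ball of `X`.
[cite: Conway1985, Ch. V §4, Prop. 4.1] -/
theorem mem_closure_image_closedBall (Φ : StrongDual ℝ (StrongDual ℝ X)) {R : ℝ}
    (hΦ : ‖Φ‖ ≤ R) : StrongDual.toWeakDual Φ ∈ closure (embed X '' closedBall (0 : X) R) := by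
  classical
  have key : ∀ p : Finset (StrongDual ℝ X) × ℕ, ∃ x ∈ closedBall (0 : X) R,
      ∀ g ∈ p.1, |g x - Φ g| < 1 / ((p.2 : ℝ) + 1) := fun p =>
    exists_mem_closedBall_forall_abs_sub_lt p.1 Φ hΦ (by positivity)
  choose x hxB hx using key
  have hlim : Tendsto (fun p => embed X (x p)) atTop (𝓝 (StrongDual.toWeakDual Φ)) := by
    refine tendsto_iff_forall_eval_tendsto_topDualPairing.mpr fun g => ?_
    simp only [topDualPairing_apply]
    rw [Metric.tendsto_atTop]
    intro ε hε
    obtain ⟨N, hN⟩ := exists_nat_one_div_lt hε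
    refine ⟨({g}, N), fun p hp => ?_⟩
    obtain ⟨hp1, hp2⟩ := Prod.mk_le_mk.mp hp
    have hg : g ∈ p.1 := hp1 (Finset.mem_singleton_self g)
    rw [Real.dist_eq]
    have hp2' : (N : ℝ) ≤ p.2 := by exact_mod_cast hp2
    calc |g (x p) - Φ g| < 1 / ((p.2 : ℝ) + 1) := hx p g hg
      _ ≤ 1 / ((N : ℝ) + 1) := by gcongr
      _ < ε := hN
  exact mem_closure_of_tendsto hlim (Eventually.of_forall fun p => ⟨x p, hxB p, rfl⟩)

/-- **Goldstine's theorem** (pointwise form): every point of the closed unit ball of `X**` is in the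
weak-* closure of the canonical image of the closed unit ball of `X`.
[cite: Conway1985, Ch. V §4, Prop. 4.1] -/
theorem mem_closure_ballImage (Φ : StrongDual ℝ (StrongDual ℝ X)) (hΦ : ‖Φ‖ ≤ 1) :
    StrongDual.toWeakDual Φ ∈ closure (ballImage X) :=
  mem_closure_image_closedBall Φ hΦ

/-- **Goldstine's theorem**: the weak-* closure of the canonical image of the closed unit ball of
`X` is exactly the closed unit ball of `X**`. [cite: Conway1985, Ch. V §4, Prop. 4.1] -/
theorem closure_ballImage_eq : closure (ballImage X) = bidualBall X := by
  refine closure_ballImage_subset.antisymm fun Ψ hΨ => ?_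
  have h := mem_closure_ballImage (WeakDual.toStrongDual Ψ) hΨ
  rwa [toWeakDual_toStrongDual] at h

/-- **Corollary**: the canonical image of `X` is weak-* dense in `X**`.
[cite: Conway1985, Ch. V §4, Prop. 4.1] -/
theorem dense_range_embed : Dense (range (embed X)) := by
  intro Ψ
  have h := mem_closure_image_closedBall (WeakDual.toStrongDual Ψ) le_rfl
  rw [toWeakDual_toStrongDual] at h
  exact closure_mono (image_subset_range _ _) h

end Literature.Analysis.FunctionSpaces.Goldstine

end
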